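import Summits.ValiantsHypothesis.ValiantsHypothesis.Theorems.NNDivisionHard.Negative.AsymmetricWindowHashCap
/-!
# AsymmetricWindow39 — PART 3b: §4 PROPOSITION H′ (`hash_carrier_cap`, `cap_combine`, `farNonneg_witness_cap`, `located_witness_cap`)
Port (val-port-1 g4; critic crit-9 g4) of val-idea-39 g6's `Cruxes/NNDivisionHard/AsymmetricWindow39.lean` REV 3 @e78aa2176e1c (7e4b5ff93693dde0) §4, second half;
texts VERBATIM, ns `Summit.ValiantsHypothesis.Theorems.NNDivisionHardNegative.AsymmetricWindow`; part 3a = `…AsymmetricWindowHashCap`.  S2 INSTRUMENTS, helper lane;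
nothing closes; `NNDivisionHard` (stmt-21181) OPEN; VP ≠ VNP NOT proved.
-/
namespace Summit.ValiantsHypothesis.Theorems.NNDivisionHardNegative.AsymmetricWindow
open Finset
open Literature.Barriers.PneNP (disjPairs mem_disjPairs IsKWValid disjPairs_filter_fst_eq)
open Literature.Combinatorics.Optimization (HasNonnegFactorization hasNonnegFactorization_of_fintype)
open Summit.ValiantsHypothesis.Theorems.NNDivisionHardNegative.BlindCubeIdentity (ind ind_nonneg ind_le_one)
open Summit.ValiantsHypothesis.Theorems.NNDivisionHardNegative.WeakReliefBlind (inv invInd invInd_nonneg)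

section HashCap
variable {n : ℕ}

/-- **Abstract hash × carrier cap.**  A fixed nonnegative carrier rectangle `u₀ v₀ᵀ`, feasible (`≤ M`) outside an exclusion relation
`X` with at most `N ≤ q/2` excluded rows per column, and `W·u₀v₀ ≥ 0` outside `X`; a pairwise-good hash family.  Then the hashed
carrier `u = u₀·1{H ξ ·}`, `v = v₀·1{no excluded row hit}` is feasible for some `ξ` and earns `Σ_{¬X} W u₀ v₀ ≤ 2q·⟨W, u vᵀ⟩`
(excluded entries — in particular all negative ones — are never touched). -/
theorem hash_carrier_cap {Row Col Ξ : Type*} [Fintype Row] [DecidableEq Row] [Fintype Col] [Fintype Ξ] [Nonempty Ξ]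
    (M W : Row → Col → ℝ) (X : Row → Col → Prop) [∀ a c, Decidable (X a c)]
    (u₀ : Row → ℝ) (v₀ : Col → ℝ) (hu₀ : ∀ a, 0 ≤ u₀ a) (hv₀ : ∀ c, 0 ≤ v₀ c)
    (H : Ξ → Row → Prop) [∀ ξ a, Decidable (H ξ a)] {q N : ℕ} (hq : 0 < q) (hqN : 2 * N ≤ q)
    (hM0 : ∀ a c, 0 ≤ M a c) (hM : ∀ a c, ¬ X a c → u₀ a * v₀ c ≤ M a c)
    (hH1 : ∀ a, (Fintype.card Ξ : ℝ) ≤ q * ((Finset.univ.filter (fun ξ => H ξ a)).card : ℝ))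
    (hH2 : ∀ a a', a ≠ a' →
      (q : ℝ) ^ 2 * ((Finset.univ.filter (fun ξ => H ξ a ∧ H ξ a')).card : ℝ) ≤ Fintype.card Ξ)
    (hN : ∀ c, (Finset.univ.filter (fun a => X a c)).card ≤ N)
    (hWX : ∀ a c, ¬ X a c → 0 ≤ W a c * (u₀ a * v₀ c)) :
    ∃ (u : Row → ℝ) (v : Col → ℝ), (∀ a, 0 ≤ u a) ∧ (∀ c, 0 ≤ v c) ∧ (∀ a c, u a * v c ≤ M a c) ∧
      (∑ a, ∑ c, if X a c then 0 else W a c * (u₀ a * v₀ c)) ≤ 2 * q * ∑ a, ∑ c, W a c * (u a * v c) := by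
  classical
  let B : Ξ → Col → Prop := fun ξ c => ∀ a', X a' c → ¬ H ξ a'
  let u : Ξ → Row → ℝ := fun ξ a => if H ξ a then u₀ a else 0
  let v : Ξ → Col → ℝ := fun ξ c => if B ξ c then v₀ c else 0
  have hu0 : ∀ ξ a, 0 ≤ u ξ a := fun ξ a => by simp only [u]; split_ifs <;> simp [hu₀]
  have hv0 : ∀ ξ c, 0 ≤ v ξ c := fun ξ c => by simp only [v]; split_ifs <;> simp [hv₀]
  have huv : ∀ ξ a c, u ξ a * v ξ c = if H ξ a ∧ B ξ c then u₀ a * v₀ c else 0 := by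
    intro ξ a c; simp only [u, v]; split_ifs <;> simp_all
  have hfeas : ∀ ξ a c, u ξ a * v ξ c ≤ M a c := by
    intro ξ a c
    rw [huv]
    split_ifs with h
    · exact hM a c fun hX => h.2 a hX h.1
    · exact hM0 a c
  have hK : ∀ a c, ¬ X a c →
      (Fintype.card Ξ : ℝ) ≤ 2 * q * ((Finset.univ.filter (fun ξ => H ξ a ∧ B ξ c)).card : ℝ) := by
    intro a c hX
    set Xc := Finset.univ.filter (fun a' => X a' c) with hXc
    have hcover : Finset.univ.filter (fun ξ => H ξ a) ⊆
        Finset.univ.filter (fun ξ => H ξ a ∧ B ξ c) ∪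
          Xc.biUnion (fun a' => Finset.univ.filter (fun ξ => H ξ a ∧ H ξ a')) := by
      intro ξ hξ
      rw [mem_filter] at hξ
      rw [Finset.mem_union, mem_filter, Finset.mem_biUnion]
      by_cases hB : B ξ c
      · exact Or.inl ⟨mem_univ _, hξ.2, hB⟩
      · right
        simp only [B, not_forall, not_not, exists_prop] at hB
        obtain ⟨a', ha'X, ha'H⟩ := hB
        exact ⟨a', mem_filter.2 ⟨mem_univ _, ha'X⟩, mem_filter.2 ⟨mem_univ _, hξ.2, ha'H⟩⟩
    have h1 : ((Finset.univ.filter (fun ξ => H ξ a)).card : ℝ) ≤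
        ((Finset.univ.filter (fun ξ => H ξ a ∧ B ξ c)).card : ℝ) +
          ∑ a' ∈ Xc, ((Finset.univ.filter (fun ξ => H ξ a ∧ H ξ a')).card : ℝ) := by
      have := (card_le_card hcover).trans
        ((Finset.card_union_le _ _).trans (Nat.add_le_add_left Finset.card_biUnion_le _))
      exact_mod_cast this
    have h2 : ∀ a' ∈ Xc, (q : ℝ) ^ 2 * ((Finset.univ.filter (fun ξ => H ξ a ∧ H ξ a')).card : ℝ) ≤
        Fintype.card Ξ := by
      intro a' ha'
      refine hH2 a a' fun h => hX ?_
      rw [h]; exact (mem_filter.1 ha').2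
    have h3 : (q : ℝ) ^ 2 * ∑ a' ∈ Xc, ((Finset.univ.filter (fun ξ => H ξ a ∧ H ξ a')).card : ℝ) ≤
        Xc.card * Fintype.card Ξ := by
      rw [Finset.mul_sum]
      have := Finset.sum_le_sum h2
      simpa using this
    have hqr : (0 : ℝ) < q := by exact_mod_cast hq
    have hNc : (Xc.card : ℝ) * 2 ≤ q := by
      have := hN c; rw [← hXc] at this
      have : (Xc.card : ℝ) ≤ N := by exact_mod_cast this
      have hqN' : (2 * N : ℝ) ≤ q := by exact_mod_cast hqN
      linarith
    have hX1 := hH1 a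
    have hcardnn : (0 : ℝ) ≤ Fintype.card Ξ := Nat.cast_nonneg _
    nlinarith [h1, h3, hNc, hX1, hqr, hcardnn,
      mul_nonneg hqr.le (Nat.cast_nonneg (Finset.univ.filter (fun ξ => H ξ a ∧ B ξ c)).card)]
  have hentry : ∀ a c, (Fintype.card Ξ : ℝ) * (if X a c then 0 else W a c * (u₀ a * v₀ c)) ≤
      2 * q * ∑ ξ, W a c * (u ξ a * v ξ c) := by
    intro a c
    have hcount : ∑ ξ, W a c * (u ξ a * v ξ c) =
        W a c * (u₀ a * v₀ c) * ((Finset.univ.filter (fun ξ => H ξ a ∧ B ξ c)).card : ℝ) := by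
      simp only [huv]
      rw [← Finset.mul_sum, Finset.sum_ite, Finset.sum_const_zero, add_zero, Finset.sum_const, nsmul_eq_mul]
      ring
    rw [hcount]
    by_cases hX : X a c
    · rw [if_pos hX]
      have hempty : Finset.univ.filter (fun ξ => H ξ a ∧ B ξ c) = ∅ := by
        rw [Finset.filter_eq_empty_iff]
        intro ξ _ h
        exact h.2 a hX h.1
      rw [hempty]; simp
    · rw [if_neg hX]
      have hKac := hK a c hX
      have hW := hWX a c hX
      nlinarith
  have hG : (Fintype.card Ξ : ℝ) * (∑ a, ∑ c, if X a c then 0 else W a c * (u₀ a * v₀ c)) ≤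
      2 * q * ∑ ξ, ∑ a, ∑ c, W a c * (u ξ a * v ξ c) := by
    have hcomm : ∑ ξ, ∑ a, ∑ c, W a c * (u ξ a * v ξ c) = ∑ a, ∑ c, ∑ ξ, W a c * (u ξ a * v ξ c) := by
      rw [Finset.sum_comm]
      exact Finset.sum_congr rfl fun a _ => Finset.sum_comm
    rw [hcomm, Finset.mul_sum, Finset.mul_sum]
    refine Finset.sum_le_sum fun a _ => ?_
    rw [Finset.mul_sum, Finset.mul_sum]
    exact Finset.sum_le_sum fun c _ => hentry a c
  obtain ⟨ξ, _, hξ⟩ := Finset.exists_le_of_sum_le (Finset.univ_nonempty (α := Ξ))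
    (f := fun _ : Ξ => ∑ a, ∑ c, if X a c then 0 else W a c * (u₀ a * v₀ c))
    (g := fun ξ => 2 * q * ∑ a, ∑ c, W a c * (u ξ a * v ξ c)) (by
      rw [Finset.sum_const, nsmul_eq_mul, Finset.card_univ, ← Finset.mul_sum]
      exact hG)
  exact ⟨u ξ, v ξ, hu0 ξ, hv0 ξ, hfeas ξ, hξ⟩

/-- bookkeeping for `located_witness_cap`: two capped parts add up to a cap by the better rectangle -/
theorem cap_combine {s q N2 crd S₁ SQ SL TT Tp A Bv : ℝ} (hq : 0 ≤ q) (hN2 : 0 ≤ N2)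
    (hr₁ : S₁ ≤ 2 * q * A) (hr₂ : Tp ≤ 2 * q * Bv) (hp : TT ≤ crd * Tp) (hcrd : crd ≤ N2) (hTp : 0 ≤ Tp)
    (hQ : s * SQ ≤ N2 * S₁) (hL : s * SL ≤ TT) :
    s * (SQ + SL) ≤ 4 * q * N2 * max A Bv := by
  have h2 : N2 * S₁ ≤ N2 * (2 * q * A) := mul_le_mul_of_nonneg_left hr₁ hN2
  have h3 : TT ≤ N2 * (2 * q * Bv) :=
    hp.trans ((mul_le_mul_of_nonneg_right hcrd hTp).trans (mul_le_mul_of_nonneg_left hr₂ hN2))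
  have hqN : 0 ≤ 2 * q * N2 := by positivity
  have h4 : 2 * q * N2 * A ≤ 2 * q * N2 * max A Bv := mul_le_mul_of_nonneg_left (le_max_left A Bv) hqN
  have h5 : 2 * q * N2 * Bv ≤ 2 * q * N2 * max A Bv := mul_le_mul_of_nonneg_left (le_max_right A Bv) hqN
  nlinarith [hQ, hL, h2, h3, h4, h5]

/-- **PROPOSITION H″ (kernel, REV 3): a hyperplane witness that is NONNEGATIVE on the far entries is capped — whatever it does on the
near entries.**  Same data as `located_witness_cap` below, but the support hypothesis `W = 0` off the near entries `inv ≤ w` is weakened to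
`0 ≤ W` there: positive far mass is caught by the same hashed carriers (the unit carrier is feasible on far entries since `M ≥ λ(w+1) ≥ s`
there, and far rows are never excluded), so it is a reward like any near positive entry.  Consequence (the word «negative» of memo §2 (C3) in
kernel): an `n^{f(λ)}` hyperplane lower bound for the located pencil REQUIRES NEGATIVE MASS ON FAR ENTRIES. -/
theorem farNonneg_witness_cap (k w q : ℕ) [NeZero q] (hn : 0 < n) (hkn : k ≤ n)
    (hqN : 2 * ((w + 1) ^ Nat.sqrt w) ^ 2 ≤ q) {lam : ℝ} (hlam : 0 ≤ lam)
    (W : {a : Finset (Fin n) // a.card = k} → Finset (Fin n) × Equiv.Perm (Fin n) → ℝ)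
    (hWfar : ∀ a c, ¬ (inv a.1 c.2 ≤ w) → 0 ≤ W a c) :
    ∃ (u : {a : Finset (Fin n) // a.card = k} → ℝ) (v : Finset (Fin n) × Equiv.Perm (Fin n) → ℝ),
      (∀ a, 0 ≤ u a) ∧ (∀ c, 0 ≤ v c) ∧ (∀ a c, u a * v c ≤ pencilEntry n lam a.1 c) ∧
      min 1 (lam * (w + 1)) * (∑ a, ∑ c, W a c * pencilEntry n lam a.1 c) ≤
        4 * q * ((n : ℝ) + 1) ^ 2 * ∑ a, ∑ c, W a c * (u a * v c) := by
  classical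
  set s := min 1 (lam * (w + 1)) with hs_def
  have hs0 : 0 ≤ s := le_min zero_le_one (mul_nonneg hlam (by positivity))
  have hs1 : s ≤ 1 := min_le_left _ _
  have hq : 0 < q := Nat.pos_of_ne_zero (NeZero.ne q)
  have hqr : (0 : ℝ) < q := by exact_mod_cast hq
  -- shared facts about the pencil and the hash family
  have hinv0 : ∀ (a : {a : Finset (Fin n) // a.card = k}) (c : Finset (Fin n) × Equiv.Perm (Fin n)),
      (0 : ℝ) ≤ (inv a.1 c.2 : ℝ) := fun a c => by exact_mod_cast inv_nonneg a.1 c.2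
  have hQle : ∀ (a : {a : Finset (Fin n) // a.card = k}) (c : Finset (Fin n) × Equiv.Perm (Fin n)),
      ((1 : ℝ) - ((a.1 ∩ c.1).card : ℝ)) ^ 2 ≤ ((n : ℝ) + 1) ^ 2 := by
    intro a c
    have ht : ((a.1 ∩ c.1).card : ℝ) ≤ n := by
      have := (Finset.card_le_univ (a.1 ∩ c.1)); rw [Fintype.card_fin] at this
      exact_mod_cast this
    have ht0 : (0 : ℝ) ≤ ((a.1 ∩ c.1).card : ℝ) := Nat.cast_nonneg _
    nlinarith
  have hM0 : ∀ (a : {a : Finset (Fin n) // a.card = k}) (c : Finset (Fin n) × Equiv.Perm (Fin n)),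
      0 ≤ pencilEntry n lam a.1 c := by
    intro a c
    simp only [pencilEntry]
    nlinarith [sq_nonneg ((1 : ℝ) - ((a.1 ∩ c.1).card : ℝ)), mul_nonneg hlam (hinv0 a c)]
  have hH1 : ∀ a : {a : Finset (Fin n) // a.card = k}, (Fintype.card ((Fin n → ZMod q) × ZMod q) : ℝ) ≤
      q * ((Finset.univ.filter (fun ξ : (Fin n → ZMod q) × ZMod q => hashOf ξ.1 a.1 = ξ.2)).card : ℝ) := by
    intro a
    have := hash_count_one (q := q) a.1
    have h' : (Fintype.card ((Fin n → ZMod q) × ZMod q) : ℝ) =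
        q * ((Finset.univ.filter (fun ξ : (Fin n → ZMod q) × ZMod q => hashOf ξ.1 a.1 = ξ.2)).card : ℝ) := by
      exact_mod_cast this.symm
    exact h'.le
  have hH2 : ∀ a a' : {a : Finset (Fin n) // a.card = k}, a ≠ a' →
      (q : ℝ) ^ 2 * ((Finset.univ.filter (fun ξ : (Fin n → ZMod q) × ZMod q =>
        hashOf ξ.1 a.1 = ξ.2 ∧ hashOf ξ.1 a'.1 = ξ.2)).card : ℝ) ≤ Fintype.card ((Fin n → ZMod q) × ZMod q) := by
    intro a a' haa
    have hne : a.1 ≠ a'.1 := fun h => haa (Subtype.ext h)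
    have := hash_count_two (q := q) hne
    have h' : (q : ℝ) ^ 2 * ((Finset.univ.filter (fun ξ : (Fin n → ZMod q) × ZMod q =>
        hashOf ξ.1 a.1 = ξ.2 ∧ hashOf ξ.1 a'.1 = ξ.2)).card : ℝ) = Fintype.card ((Fin n → ZMod q) × ZMod q) := by
      exact_mod_cast this
    exact h'.le
  have hnearN : ∀ c : Finset (Fin n) × Equiv.Perm (Fin n),
      (Finset.univ.filter (fun a : {a : Finset (Fin n) // a.card = k} => inv a.1 c.2 ≤ (w : ℤ))).card ≤
        ((w + 1) ^ Nat.sqrt w) ^ 2 := by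
    intro c
    calc (Finset.univ.filter (fun a : {a : Finset (Fin n) // a.card = k} => inv a.1 c.2 ≤ (w : ℤ))).card
        ≤ ((Finset.univ : Finset (Finset (Fin n))).filter (fun a => a.card = k ∧ inv a c.2 ≤ w)).card := by
          refine Finset.card_le_card_of_injOn Subtype.val ?_ ?_
          · intro a ha
            rw [Finset.mem_coe, mem_filter] at ha
            rw [Finset.mem_coe, mem_filter]
            exact ⟨mem_univ _, a.2, ha.2⟩
          · intro a _ a' _ h
            exact Subtype.ext h
      _ ≤ ((w + 1) ^ Nat.sqrt w) ^ 2 := card_informative_rows_le c.2 hkn w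
  -- RECTANGLE 1: hashed unit carrier, excluding level-1 and negative near rows
  let X₁ : {a : Finset (Fin n) // a.card = k} → Finset (Fin n) × Equiv.Perm (Fin n) → Prop :=
    fun a c => inv a.1 c.2 ≤ (w : ℤ) ∧ ((a.1 ∩ c.1).card = 1 ∨ W a c < 0)
  have hside_f1 : ∀ a c, ¬ X₁ a c → (fun _ : {a : Finset (Fin n) // a.card = k} => s) a *
      (fun _ : Finset (Fin n) × Equiv.Perm (Fin n) => (1 : ℝ)) c ≤ (pencilEntry n lam ∘ Subtype.val) a c := by
    intro a c hX
    simp only [Function.comp, pencilEntry, mul_one]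
    by_cases hn' : inv a.1 c.2 ≤ (w : ℤ)
    · have hl : (a.1 ∩ c.1).card ≠ 1 := fun h => hX ⟨hn', Or.inl h⟩
      have hsq := one_le_sq_one_sub_of_ne_one hl
      nlinarith [mul_nonneg hlam (hinv0 a c)]
    · have hfar : ((w : ℝ) + 1) ≤ (inv a.1 c.2 : ℝ) := by
        have : (w : ℤ) + 1 ≤ inv a.1 c.2 := by omega
        exact_mod_cast this
      have := min_le_right (1 : ℝ) (lam * (w + 1))
      nlinarith [mul_le_mul_of_nonneg_left hfar hlam, sq_nonneg ((1 : ℝ) - ((a.1 ∩ c.1).card : ℝ))]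
  have hside_n1 : ∀ c, (Finset.univ.filter (fun a => X₁ a c)).card ≤ ((w + 1) ^ Nat.sqrt w) ^ 2 := by
    intro c
    refine (Finset.card_le_card ?_).trans (hnearN c)
    intro a ha
    rw [mem_filter] at ha ⊢
    exact ⟨ha.1, ha.2.1⟩
  have hside_w1 : ∀ a c, ¬ X₁ a c → 0 ≤ W a c * ((fun _ : {a : Finset (Fin n) // a.card = k} => s) a *
      (fun _ : Finset (Fin n) × Equiv.Perm (Fin n) => (1 : ℝ)) c) := by
    intro a c hX
    by_cases hn' : inv a.1 c.2 ≤ (w : ℤ)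
    · have hW : 0 ≤ W a c := by
        by_contra h
        exact hX ⟨hn', Or.inr (lt_of_not_ge h)⟩
      exact mul_nonneg hW (mul_nonneg hs0 zero_le_one)
    · exact mul_nonneg (hWfar a c hn') (mul_nonneg hs0 zero_le_one)
  obtain ⟨u₁, v₁, hu₁, hv₁, hf₁, hr₁⟩ := hash_carrier_cap (Ξ := (Fin n → ZMod q) × ZMod q)
    (pencilEntry n lam ∘ Subtype.val) W X₁ (fun _ => s) (fun _ => (1 : ℝ)) (fun _ => hs0) (fun _ => zero_le_one)
    (fun ξ a => hashOf ξ.1 a.1 = ξ.2) hq hqN hM0 hside_f1 hH1 hH2 hside_n1 hside_w1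
  -- RECTANGLE 2 (one per inversion pair p = (l, l′)): hashed inversion carrier, excluding negative near rows
  let X₂ : {a : Finset (Fin n) // a.card = k} → Finset (Fin n) × Equiv.Perm (Fin n) → Prop :=
    fun a c => inv a.1 c.2 ≤ (w : ℤ) ∧ W a c < 0
  let cu : Fin n × Fin n → {a : Finset (Fin n) // a.card = k} → ℝ :=
    fun p a => lam * ((ind a.1 p.1 : ℝ) * (1 - (ind a.1 p.2 : ℝ)))
  let cv : Fin n × Fin n → Finset (Fin n) × Equiv.Perm (Fin n) → ℝ := fun p c => (invInd c.2 p.1 p.2 : ℝ)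
  have hcu : ∀ p a, 0 ≤ cu p a := by
    intro p a
    have h1 : (0 : ℝ) ≤ (ind a.1 p.1 : ℝ) := by exact_mod_cast ind_nonneg a.1 p.1
    have h2 : (ind a.1 p.2 : ℝ) ≤ 1 := by exact_mod_cast ind_le_one a.1 p.2
    exact mul_nonneg hlam (mul_nonneg h1 (by linarith))
  have hcv : ∀ p c, 0 ≤ cv p c := fun p c => by
    simp only [cv]; exact_mod_cast invInd_nonneg c.2 p.1 p.2
  have hterm_le : ∀ p a c, cu p a * cv p c ≤ lam * (inv a.1 c.2 : ℝ) := by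
    intro p a c
    simp only [cu, cv]
    rw [inv_cast_sum, mul_assoc]
    refine mul_le_mul_of_nonneg_left ?_ hlam
    refine Finset.single_le_sum (f := fun p' : Fin n × Fin n =>
        ((ind a.1 p'.1 : ℝ) * (1 - (ind a.1 p'.2 : ℝ))) * (invInd c.2 p'.1 p'.2 : ℝ)) ?_ (mem_univ p)
    intro p' _
    have h1 : (0 : ℝ) ≤ (ind a.1 p'.1 : ℝ) := by exact_mod_cast ind_nonneg a.1 p'.1
    have h2 : (ind a.1 p'.2 : ℝ) ≤ 1 := by exact_mod_cast ind_le_one a.1 p'.2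
    have h3 : (0 : ℝ) ≤ (invInd c.2 p'.1 p'.2 : ℝ) := by exact_mod_cast invInd_nonneg c.2 p'.1 p'.2
    exact mul_nonneg (mul_nonneg h1 (by linarith)) h3
  have hR2 : ∀ p : Fin n × Fin n, ∃ (u : {a : Finset (Fin n) // a.card = k} → ℝ)
      (v : Finset (Fin n) × Equiv.Perm (Fin n) → ℝ),
      (∀ a, 0 ≤ u a) ∧ (∀ c, 0 ≤ v c) ∧ (∀ a c, u a * v c ≤ (pencilEntry n lam ∘ Subtype.val) a c) ∧
      (∑ a, ∑ c, if X₂ a c then 0 else W a c * (cu p a * cv p c)) ≤ 2 * q * ∑ a, ∑ c, W a c * (u a * v c) := by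
    intro p
    refine hash_carrier_cap (Ξ := (Fin n → ZMod q) × ZMod q) (pencilEntry n lam ∘ Subtype.val) W X₂ (cu p) (cv p)
      (hcu p) (hcv p) (fun ξ a => hashOf ξ.1 a.1 = ξ.2) hq hqN hM0 ?_ hH1 hH2 ?_ ?_
    · intro a c _
      simp only [Function.comp, pencilEntry]
      nlinarith [hterm_le p a c, sq_nonneg ((1 : ℝ) - ((a.1 ∩ c.1).card : ℝ))]
    · intro c
      refine (Finset.card_le_card ?_).trans (hnearN c)
      intro a ha
      rw [mem_filter] at ha ⊢
      exact ⟨ha.1, ha.2.1⟩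
    · intro a c hX
      by_cases hn' : inv a.1 c.2 ≤ (w : ℤ)
      · have hW : 0 ≤ W a c := by
          by_contra h
          exact hX ⟨hn', lt_of_not_ge h⟩
        exact mul_nonneg hW (mul_nonneg (hcu p a) (hcv p c))
      · exact mul_nonneg (hWfar a c hn') (mul_nonneg (hcu p a) (hcv p c))
  choose u₂ v₂ hu₂ hv₂ hf₂ hr₂ using hR2
  -- the located part summed over the pairs is `Σ_{¬X₂} W·λ·inv`
  let T : Fin n × Fin n → ℝ := fun p => ∑ a, ∑ c, if X₂ a c then 0 else W a c * (cu p a * cv p c)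
  have hTsum : ∑ p, T p = ∑ a, ∑ c, if X₂ a c then 0 else W a c * (lam * (inv a.1 c.2 : ℝ)) := by
    simp only [T]
    rw [Finset.sum_comm]
    refine Finset.sum_congr rfl fun a _ => ?_
    rw [Finset.sum_comm]
    refine Finset.sum_congr rfl fun c _ => ?_
    by_cases hX : X₂ a c
    · simp [hX]
    · simp only [if_neg hX]
      rw [← Finset.mul_sum, inv_cast_sum, Finset.mul_sum, Finset.mul_sum, Finset.mul_sum]
      refine Finset.sum_congr rfl fun p _ => ?_
      simp only [cu, cv]; ring
  -- pigeonhole over the n² pairs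
  haveI : Nonempty (Fin n × Fin n) := ⟨(⟨0, hn⟩, ⟨0, hn⟩)⟩
  obtain ⟨p₀, _, hp₀⟩ := Finset.exists_le_of_sum_le (Finset.univ_nonempty (α := Fin n × Fin n))
    (f := fun _ : Fin n × Fin n => ∑ p, T p) (g := fun p => (Fintype.card (Fin n × Fin n) : ℝ) * T p) (by
      rw [Finset.sum_const, nsmul_eq_mul, Finset.card_univ, ← Finset.mul_sum])
  have hcardp : (Fintype.card (Fin n × Fin n) : ℝ) ≤ ((n : ℝ) + 1) ^ 2 := by
    rw [Fintype.card_prod, Fintype.card_fin]; push_cast; nlinarith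
  -- (i) the quadratic part against rectangle 1
  have hQpart : s * ∑ a, ∑ c, W a c * ((1 : ℝ) - ((a.1 ∩ c.1).card : ℝ)) ^ 2 ≤
      ((n : ℝ) + 1) ^ 2 * ∑ a, ∑ c, (if X₁ a c then 0 else W a c * (s * 1)) := by
    rw [Finset.mul_sum, Finset.mul_sum]
    refine Finset.sum_le_sum fun a _ => ?_
    rw [Finset.mul_sum, Finset.mul_sum]
    refine Finset.sum_le_sum fun c _ => ?_
    have hQ0 := sq_nonneg ((1 : ℝ) - ((a.1 ∩ c.1).card : ℝ))
    by_cases hX : X₁ a c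
    · rw [if_pos hX, mul_zero]
      rcases hX.2 with h1 | hneg
      · rw [h1]; simp
      · nlinarith [mul_nonneg hs0 hQ0]
    · rw [if_neg hX]
      by_cases hn' : inv a.1 c.2 ≤ (w : ℤ)
      · have hW : 0 ≤ W a c := by
          by_contra h
          exact hX ⟨hn', Or.inr (lt_of_not_ge h)⟩
        nlinarith [hQle a c, mul_nonneg hW hs0, mul_nonneg (mul_nonneg hW hs0) hQ0]
      · have hW := hWfar a c hn'
        nlinarith [hQle a c, mul_nonneg hW hs0, mul_nonneg (mul_nonneg hW hs0) hQ0]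
  -- (ii) the located part against the T-sum
  have hLpart : s * ∑ a, ∑ c, W a c * (lam * (inv a.1 c.2 : ℝ)) ≤ ∑ p, T p := by
    rw [hTsum, Finset.mul_sum]
    refine Finset.sum_le_sum fun a _ => ?_
    rw [Finset.mul_sum]
    refine Finset.sum_le_sum fun c _ => ?_
    have hL0 : 0 ≤ lam * (inv a.1 c.2 : ℝ) := mul_nonneg hlam (hinv0 a c)
    by_cases hX : X₂ a c
    · rw [if_pos hX]
      nlinarith [mul_nonneg hs0 hL0, hX.2]
    · rw [if_neg hX]
      by_cases hn' : inv a.1 c.2 ≤ (w : ℤ)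
      · have hW : 0 ≤ W a c := by
          by_contra h
          exact hX ⟨hn', lt_of_not_ge h⟩
        nlinarith [mul_nonneg hW hL0]
      · have hW := hWfar a c hn'
        nlinarith [mul_nonneg hW hL0]
  -- combine
  have hsplit : ∑ a, ∑ c, W a c * pencilEntry n lam a.1 c =
      ∑ a, ∑ c, W a c * ((1 : ℝ) - ((a.1 ∩ c.1).card : ℝ)) ^ 2 + ∑ a, ∑ c, W a c * (lam * (inv a.1 c.2 : ℝ)) := by
    rw [← Finset.sum_add_distrib]
    refine Finset.sum_congr rfl fun a _ => ?_
    rw [← Finset.sum_add_distrib]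
    refine Finset.sum_congr rfl fun c _ => ?_
    simp only [pencilEntry]; ring
  have hT0' : 0 ≤ T p₀ := by
    simp only [T]
    refine Finset.sum_nonneg fun a _ => Finset.sum_nonneg fun c _ => ?_
    by_cases hX : X₂ a c
    · simp [hX]
    · rw [if_neg hX]
      by_cases hn' : inv a.1 c.2 ≤ (w : ℤ)
      · have hW : 0 ≤ W a c := by
          by_contra h
          exact hX ⟨hn', lt_of_not_ge h⟩
        exact mul_nonneg hW (mul_nonneg (hcu p₀ a) (hcv p₀ c))
      · exact mul_nonneg (hWfar a c hn') (mul_nonneg (hcu p₀ a) (hcv p₀ c))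
  have hmain := cap_combine (s := s) hqr.le (sq_nonneg ((n : ℝ) + 1)) hr₁ (hr₂ p₀) hp₀ hcardp hT0' hQpart hLpart
  rw [← hsplit] at hmain
  -- choose the better of the two rectangles
  rcases le_total (∑ a, ∑ c, W a c * (u₁ a * v₁ c)) (∑ a, ∑ c, W a c * (u₂ p₀ a * v₂ p₀ c)) with hcmp | hcmp
  · refine ⟨u₂ p₀, v₂ p₀, hu₂ p₀, hv₂ p₀, hf₂ p₀, ?_⟩
    rwa [max_eq_right hcmp] at hmain
  · refine ⟨u₁, v₁, hu₁, hv₁, hf₁, ?_⟩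
    rwa [max_eq_left hcmp] at hmain

/-- **PROPOSITION H′ (kernel): EVERY hyperplane witness supported on the near entries of a slice is capped — whatever its sign
pattern across intersection levels.**  Slice `|a| = k ≤ n` (`0 < n`), budget `w`, `λ ≥ 0`, modulus `q ≥ 2((w+1)^{√w})²`; `W` any real
weight on slice-rows × columns with `W = 0` off the near entries `inv ≤ w`.  Then some feasible rectangle `u vᵀ ≤ M_λ` has
`s·⟨W, M_λ⟩ ≤ 4q(n+1)²·⟨W, u vᵀ⟩`, `s = min(1, λ(w+1))`: the hyperplane bound of `W` is `≤ 4q(n+1)²/s = poly(n)·2^{O(√w log w)}` —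
no `n^{f(λ)}`.  The rectangle is either the hashed unit carrier (excluding columns with a hit level-1 or negative near row; pays the
`(1−t)²` part) or a hashed INVERSION carrier `λ[l∈a][l′∉a] ⊗ [π(l′)<π(l)]` (excluding columns with a hit negative row; pays the flood part
`λ·inv`, which is an `n²`-slot cone term, §2).  Consequence for the window: located (near-supported) hyperplane witnesses are EXACTLY
T3-strength; an `n^{f(λ)}` lower bound needs NEGATIVE mass on FAR entries (`inv > w`) — PROPOSITION H″ `farNonneg_witness_cap` above, of which
this is the special case `W = 0` off the near entries — or a non-hyperplane argument (memo §2). -/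
theorem located_witness_cap (k w q : ℕ) [NeZero q] (hn : 0 < n) (hkn : k ≤ n)
    (hqN : 2 * ((w + 1) ^ Nat.sqrt w) ^ 2 ≤ q) {lam : ℝ} (hlam : 0 ≤ lam)
    (W : {a : Finset (Fin n) // a.card = k} → Finset (Fin n) × Equiv.Perm (Fin n) → ℝ)
    (hWfar : ∀ a c, ¬ (inv a.1 c.2 ≤ w) → W a c = 0) :
    ∃ (u : {a : Finset (Fin n) // a.card = k} → ℝ) (v : Finset (Fin n) × Equiv.Perm (Fin n) → ℝ),
      (∀ a, 0 ≤ u a) ∧ (∀ c, 0 ≤ v c) ∧ (∀ a c, u a * v c ≤ pencilEntry n lam a.1 c) ∧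
      min 1 (lam * (w + 1)) * (∑ a, ∑ c, W a c * pencilEntry n lam a.1 c) ≤
        4 * q * ((n : ℝ) + 1) ^ 2 * ∑ a, ∑ c, W a c * (u a * v c) :=
  farNonneg_witness_cap k w q hn hkn hqN hlam W (fun a c h => (hWfar a c h).symm.le)

end HashCap

end Summit.ValiantsHypothesis.Theorems.NNDivisionHardNegative.AsymmetricWindow
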